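import Summits.RiemannHypothesis.RiemannHypothesis.Theorems.PfPersistenceEdgeLaw
import HarnessLib

/-!
# The edge law is UNIVERSAL: one theorem over the windowed-form interface (class (W)), with ζ's
# Weil form and every dilation-covariant sub-family (Galerkin sections) as instances
# (pub-rhpf, theory-1 gen 4; helper for crux `EvenSectorBarta.EvenOneSignedWindows`,
# item stmt-RiemannHypothesis-19953; RH-free)

**mechanism/rigidity campaign; no RH claims.**  Companion text:
`run/shared/lean/pub/pub-rhpf/pub-rhpf-theory-1/THEORY-EDGE-4.md`.

The tree proves the Hadamard–Hellmann–Feynman EDGE LAW in virial form, `a · ε'(a) = −V(u)`, for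
the window bottom `ε = weilGroundEnergy` of ζ's Weil form (`PfPersistenceEdgeLaw`,
`PfPersistenceProfileDeriv`, `PfPersistenceProfileDerivPrime`).  Adjudication A58 of the campaign
recorded that its universality across the class (W) of windowed forms — every control family of the
observatory — was so far PROOF-INSPECTION, not a tree theorem ("no decl quantifies over the class").
This file supplies that decl.

## §1 The interface `WindowForm` (class (W)) and the universal edge law (PROVED, sorry-free)

A `WindowForm` is: a window-independent closed form `form : (ℝ → ℂ) → ℝ`, a predicate
`Adm b f` ("`f` is an admissible unit state of the window `[-b, b]`"), a window bottom
`energy : ℝ → ℝ`, and the VARIATIONAL PRINCIPLE `energy_le : Adm b f → energy b ≤ form f`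
(closedness of the form from above on its domain).  Nothing else: no arithmetic, no kernel, no
positivity.  `W.IsGround a u` (admissible and attains the bottom), `W.DilationCovariantAt a`
(Bombieri's unitary dilation `weilDilate η`, `-1/2 ≤ η ≤ 1`, maps admissible states of the window
`a` to admissible states of the window `a/(1+η)` — the parameter MOVES THE DOMAIN, Hadamard 1908),
`W.profile u η = form (weilDilate η u)`.

* `WindowForm.mul_deriv_energy_eq_neg` — **THE UNIVERSAL EDGE LAW**: for EVERY `W : WindowForm`,
  every window `a` with `W.DilationCovariantAt a` at which `W.energy` is differentiable, and every
  ground state `u` whose profile has derivative `V` at `η = 0`: `a · (W.energy)'(a) = −V`.  Proof =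
  touching (`energy_div_le_profile`: variational principle ∘ covariance) + contact (`profile_zero`)
  + the one-touching-family envelope lemma of `PfPersistenceEdgeLaw` (Fermat).  One-sided Dini
  versions (`neg_le_mul_deriv_energy`, `mul_deriv_energy_le_neg`), uniqueness of the virial across
  the ground states of a window (`profile_deriv_unique`), `HasDerivAt` packaging.
* `WindowForm.antitoneOn_energy_of_isGround`, `ae_differentiableAt_energy`,
  `ae_mul_deriv_energy_eq_neg`: with window-monotone admissibility and ground states at every
  window the bottom is antitone (Bombieri Thm 5 in the abstract), hence differentiable a.e., hence
  the law holds at a.e. window for every ground state with a differentiable profile.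
* `WindowForm.restrict P` (§1b): restricting admissibility by ANY window-indexed predicate `P`
  (energy := the infimum over the sub-family) is again a `WindowForm`, dilation-covariant at `a` when
  `P` is; so every dilation-covariant SUB-FAMILY — in particular every Galerkin section whose trial
  space at the window `b` is the dilate of a fixed space (the observatory's cosine/sine blocks on
  `[-a, a]`) — obeys the same law at its own attained, differentiable bottoms
  (`mul_deriv_restrict_energy_eq_neg`): the finite-`N` "exact dilation identity" of the campaign's
  DATA (PF.md §15.3) as a theorem-schema.

## §2 Instance: ζ's Weil form (PROVED) — the tree theorem recovered

`weilWindowForm A` (`form = weilClosedForm (2A)`, `Adm = weilAdm A`: `0 < b ≤ 2A`, `L²`, vanishing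
at `|x| ≥ b`, unit mass, finite archimedean energy; `energy = weilGroundEnergy`; variational
principle = `stub_formDomainPos` + window change `stub_localizedCut_energy_window`) is a
`WindowForm`, dilation-covariant at every `a ≤ A` (`integrableOn_arch_weilDilate`,
unitarity), and the truncation `weilTrunc a u` of a Weil ground state is a ground state of it
(`stub_groundStateEnergy`); its profile is `weilDilationProfile a u` by `rfl`.  Hence
`mul_deriv_weilGroundEnergy_eq_neg_of_le` — the edge law with the profile read at ANY reference
window `A ≥ a` (for `A = a` literally the tree's `mul_deriv_weilGroundEnergy_eq_neg`), and the
reference-window independence of the virial (`weilProfile_deriv_eq_of_le`).  What distinguishes ζ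
from a control family is therefore NOT the law (PROVED universal) but only the SIZE of
`V(u_a)/ε(a)` (the leakage rate; uniform control RH-equivalent in the tree,
`relEdgeMassLaw_iff_riemannHypothesis`).

## §3 (companion file `PfPersistenceProfileDerivLag`)

The residual hypothesis of the ζ edge law made literal: the prime-lag part of the profile is
differentiable at `η = 0` as soon as `t ↦ D_t(ũ)` is differentiable at the prime-power lags in the
window (chain rule) — see `hasDerivAt_weilPrimeLagPart_of_hasDerivAt_weilIncrement` there.

References: J. Hadamard, Mém. prés. div. sav. Acad. Sci. 33 (1908); T. Kato, *Perturbation Theory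
for Linear Operators* (1966) VII §4.6, VII §6.5; E. Bombieri, Rend. Mat. Acc. Lincei (9) 11 (2000)
183–233, §4 (Thm 5 and its proof: the dilation); P. R. Garabedian, M. Schiffer, J. Anal. Math. 2
(1952/53) 281–368.
-/

set_option linter.dupNamespace false

noncomputable section

open MeasureTheory Set Filter
open scoped Topology

namespace Summit.RiemannHypothesis.RiemannHypothesis.Theorems.PfPersistence

open Literature.NumberTheory.LFunctions
open Summit.RiemannHypothesis.RiemannHypothesis.Theorems.WeilWindowFlowWindowLipschitz
  (stub_formDomainPos stub_groundStateEnergy stub_localizedCut_energy_window)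
open Summit.RiemannHypothesis.RiemannHypothesis.Theorems.OddSector (memLp_weilDilate)

/-! ## §1 The windowed-form interface and the universal edge law -/

/-- **A WINDOWED VARIATIONAL FORM (class (W) interface).** A window-independent closed form
`form`, the admissible unit states `Adm b f` of each window `[-b, b]`, the window bottom `energy`,
and the variational principle `energy b ≤ form f` for admissible `f` (closedness from above).
Instances: ζ's Weil form (`weilWindowForm`), and every restriction to a sub-family (`restrict`).
[folklore] -/
structure WindowForm where
  /-- the closed form, read window-independently -/
  form : (ℝ → ℂ) → ℝ
  /-- admissible unit states of the window `[-b, b]` -/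
  Adm : ℝ → (ℝ → ℂ) → Prop
  /-- the window bottom -/
  energy : ℝ → ℝ
  /-- the variational principle: the bottom lies below the form of every admissible state -/
  energy_le : ∀ ⦃b : ℝ⦄ ⦃f : ℝ → ℂ⦄, Adm b f → energy b ≤ form f

namespace WindowForm

variable (W : WindowForm)

/-- A GROUND STATE of the window `a`: admissible and attaining the bottom. [folklore] -/
def IsGround (a : ℝ) (u : ℝ → ℂ) : Prop :=
  W.Adm a u ∧ W.form u = W.energy a

/-- DILATION COVARIANCE at the window `a`: Bombieri's unitary dilation `weilDilate η`
(`-1/2 ≤ η ≤ 1`) maps admissible states of the window `a` to admissible states of the window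
`a/(1+η)` — the parameter moves the domain. [cite: Bombieri2000Weil, §4 proof of Thm 5 (the dilation)] -/
def DilationCovariantAt (a : ℝ) : Prop :=
  ∀ ⦃f : ℝ → ℂ⦄ ⦃η : ℝ⦄, W.Adm a f → -(1 / 2 : ℝ) ≤ η → η ≤ 1 →
    W.Adm (a / (1 + η)) (weilDilate η f)

/-- The DILATION PROFILE of a state: the form along its dilation orbit. Its derivative at `η = 0`,
when it exists, is the dilation virial of the state. [folklore] -/
def profile (u : ℝ → ℂ) (η : ℝ) : ℝ :=
  W.form (weilDilate η u)

variable {W}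

/-- TOUCHING FROM ABOVE: `energy (a/(1+η)) ≤ profile u η` for a ground state `u` of a
dilation-covariant window `a` and `-1/2 ≤ η ≤ 1` (variational principle ∘ covariance). [folklore] -/
theorem energy_div_le_profile {a : ℝ} {u : ℝ → ℂ} (hcov : W.DilationCovariantAt a)
    (hu : W.IsGround a u) {η : ℝ} (hη : -(1 / 2 : ℝ) ≤ η) (hη1 : η ≤ 1) :
    W.energy (a / (1 + η)) ≤ W.profile u η :=
  W.energy_le (hcov hu.1 hη hη1)

/-- CONTACT at `η = 0`: `profile u 0 = energy a` for a ground state `u` of the window `a`. [folklore] -/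
theorem profile_zero {a : ℝ} {u : ℝ → ℂ} (hu : W.IsGround a u) : W.profile u 0 = W.energy a := by
  simp only [profile, weilDilate_zero]
  exact hu.2

/-- The touching inequality holds for all `η` near `0`. [folklore] -/
theorem eventually_energy_div_le {a : ℝ} {u : ℝ → ℂ} (hcov : W.DilationCovariantAt a)
    (hu : W.IsGround a u) :
    ∀ᶠ η : ℝ in 𝓝 0, W.energy (a / (1 + η)) ≤ W.profile u η := by
  filter_upwards [Icc_mem_nhds (show (-(1 / 2 : ℝ)) < 0 by norm_num) (show (0 : ℝ) < 1 by norm_num)]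
    with η hη
  exact energy_div_le_profile hcov hu hη.1 hη.2

/-- **THE UNIVERSAL EDGE LAW (Hadamard–Hellmann–Feynman, virial form).** For every windowed form
`W`, every dilation-covariant window `a` at which the bottom is differentiable, and EVERY ground state
`u` of that window whose dilation profile has derivative `V` at `η = 0`:
`a · (W.energy)'(a) = −V`.  No simplicity of the level, no regularity of `u`, no arithmetic.
[cite: Kato1966, VII §4.6 and VII §6.5 (Hellmann–Feynman for forms; forms with varying domain)] -/
theorem mul_deriv_energy_eq_neg {a : ℝ} {u : ℝ → ℂ} (hcov : W.DilationCovariantAt a)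
    (hu : W.IsGround a u) (hd : DifferentiableAt ℝ W.energy a) {V : ℝ}
    (hV : HasDerivAt (W.profile u) V 0) : a * deriv W.energy a = -V := by
  have he := hasDerivAt_comp_window_div hd.hasDerivAt
  have heq : W.energy (a / (1 + 0)) = W.profile u 0 := by
    rw [add_zero, div_one, profile_zero hu]
  have h := envelope_hasDerivAt_eq (eventually_energy_div_le hcov hu) heq he hV
  linarith

/-- One-sided universal edge law (compression side): a right derivative `V₊` of the profile at
`0` gives `−V₊ ≤ a · energy'(a)`. [folklore] -/
theorem neg_le_mul_deriv_energy {a : ℝ} {u : ℝ → ℂ} (hcov : W.DilationCovariantAt a)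
    (hu : W.IsGround a u) (hd : DifferentiableAt ℝ W.energy a) {V : ℝ}
    (hV : HasDerivWithinAt (W.profile u) V (Ioi 0) 0) : -V ≤ a * deriv W.energy a := by
  have he := hasDerivAt_comp_window_div hd.hasDerivAt
  have heq : W.energy (a / (1 + 0)) = W.profile u 0 := by
    rw [add_zero, div_one, profile_zero hu]
  have h := envelope_le_of_hasDerivWithinAt_Ioi
    ((eventually_energy_div_le hcov hu).filter_mono nhdsWithin_le_nhds) heq he hV
  linarith

/-- One-sided universal edge law (expansion side): a left derivative `V₋` of the profile at `0`
gives `a · energy'(a) ≤ −V₋`. [folklore] -/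
theorem mul_deriv_energy_le_neg {a : ℝ} {u : ℝ → ℂ} (hcov : W.DilationCovariantAt a)
    (hu : W.IsGround a u) (hd : DifferentiableAt ℝ W.energy a) {V : ℝ}
    (hV : HasDerivWithinAt (W.profile u) V (Iio 0) 0) : a * deriv W.energy a ≤ -V := by
  have he := hasDerivAt_comp_window_div hd.hasDerivAt
  have heq : W.energy (a / (1 + 0)) = W.profile u 0 := by
    rw [add_zero, div_one, profile_zero hu]
  have h := envelope_ge_of_hasDerivWithinAt_Iio
    ((eventually_energy_div_le hcov hu).filter_mono nhdsWithin_le_nhds) heq he hV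
  linarith

/-- All ground states of a (covariant, differentiability) window with differentiable profiles have
the SAME virial. [folklore] -/
theorem profile_deriv_unique {a : ℝ} {u v : ℝ → ℂ} (hcov : W.DilationCovariantAt a)
    (hu : W.IsGround a u) (hv : W.IsGround a v) (hd : DifferentiableAt ℝ W.energy a) {V V' : ℝ}
    (hV : HasDerivAt (W.profile u) V 0) (hV' : HasDerivAt (W.profile v) V' 0) : V = V' := by
  have h1 := mul_deriv_energy_eq_neg hcov hu hd hV
  have h2 := mul_deriv_energy_eq_neg hcov hv hd hV'
  linarith

/-- `HasDerivAt` packaging of the universal edge law: `energy'(a) = −V/a` (`a ≠ 0`). [folklore] -/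
theorem hasDerivAt_energy {a : ℝ} {u : ℝ → ℂ} (ha : a ≠ 0) (hcov : W.DilationCovariantAt a)
    (hu : W.IsGround a u) (hd : DifferentiableAt ℝ W.energy a) {V : ℝ}
    (hV : HasDerivAt (W.profile u) V 0) : HasDerivAt W.energy (-V / a) a := by
  have h := mul_deriv_energy_eq_neg hcov hu hd hV
  have e : deriv W.energy a = -V / a := by
    rw [eq_div_iff ha]
    linarith
  rw [← e]
  exact hd.hasDerivAt

/-- **The bottom is antitone** (Bombieri's Thm 5 in the abstract): if admissibility is monotone in
the window and every window `a > 0` carries a ground state, then `b ↦ energy b` is antitone on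
`(0, ∞)`. [cite: Bombieri2000Weil, §4 Thm 5] -/
theorem antitoneOn_energy_of_isGround
    (hmono : ∀ ⦃a b : ℝ⦄ ⦃f : ℝ → ℂ⦄, W.Adm a f → a ≤ b → W.Adm b f)
    (hex : ∀ a : ℝ, 0 < a → ∃ u : ℝ → ℂ, W.IsGround a u) : AntitoneOn W.energy (Ioi 0) := by
  intro a ha b _ hab
  obtain ⟨u, hu⟩ := hex a ha
  calc W.energy b ≤ W.form u := W.energy_le (hmono hu.1 hab)
    _ = W.energy a := hu.2

/-- An antitone bottom is differentiable at almost every window `a > 0` (Lebesgue). [folklore] -/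
theorem ae_differentiableAt_energy (hanti : AntitoneOn W.energy (Ioi 0)) :
    ∀ᵐ a : ℝ, 0 < a → DifferentiableAt ℝ W.energy a := by
  have hmono : MonotoneOn (fun a : ℝ ↦ -W.energy a) (Ioi 0) := fun b hb a ha hba ↦
    neg_le_neg (hanti hb ha hba)
  filter_upwards [hmono.ae_differentiableWithinAt_of_mem] with a ha hpos
  have h1 : DifferentiableWithinAt ℝ (fun a : ℝ ↦ -W.energy a) (Ioi 0) a := ha hpos
  have h2 : DifferentiableAt ℝ (fun a : ℝ ↦ -W.energy a) a :=
    h1.differentiableAt (Ioi_mem_nhds hpos)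
  simpa using h2.neg

/-- **The universal edge law at almost every window**: for a windowed form with antitone bottom,
dilation-covariant at every window, a.e. `a > 0` has `a · energy'(a) = −V` for every ground state
`u` of the window `a` with profile derivative `V`. [folklore] -/
theorem ae_mul_deriv_energy_eq_neg (hanti : AntitoneOn W.energy (Ioi 0))
    (hcov : ∀ a : ℝ, 0 < a → W.DilationCovariantAt a) :
    ∀ᵐ a : ℝ, 0 < a → ∀ (u : ℝ → ℂ) (V : ℝ), W.IsGround a u →
      HasDerivAt (W.profile u) V 0 → a * deriv W.energy a = -V := by
  filter_upwards [ae_differentiableAt_energy hanti] with a ha hpos u V hu hV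
  exact mul_deriv_energy_eq_neg (hcov a hpos) hu (ha hpos) hV

/-! ## §1b Sub-families: restriction by a window-indexed predicate (Galerkin sections) -/

/-- **Restriction of a windowed form to a sub-family** `P b f` of admissible states (e.g. a Galerkin
trial space per window): same form, admissibility `Adm b f ∧ P b f`, bottom := the infimum of the
form over the sub-family (bounded below by the ambient bottom). [folklore] -/
def restrict (P : ℝ → (ℝ → ℂ) → Prop) : WindowForm where
  form := W.form
  Adm b f := W.Adm b f ∧ P b f
  energy b := sInf (W.form '' {f | W.Adm b f ∧ P b f})
  energy_le := by
    intro b f hf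
    refine csInf_le ⟨W.energy b, ?_⟩ ⟨f, hf, rfl⟩
    rintro _ ⟨g, hg, rfl⟩
    exact W.energy_le hg.1

/-- The restricted bottom lies above the ambient bottom (when the sub-family of the window is
nonempty). [folklore] -/
theorem energy_le_restrict_energy {P : ℝ → (ℝ → ℂ) → Prop} {b : ℝ}
    (hne : ∃ f : ℝ → ℂ, W.Adm b f ∧ P b f) : W.energy b ≤ (W.restrict P).energy b := by
  obtain ⟨f, hf⟩ := hne
  refine le_csInf ⟨W.form f, f, hf, rfl⟩ ?_
  rintro _ ⟨g, hg, rfl⟩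
  exact W.energy_le hg.1

/-- A restriction by a predicate that is itself dilation-covariant at `a` (the trial space of the
window `a/(1+η)` contains the dilates of the trial space of the window `a`) is dilation-covariant at
`a`. [folklore] -/
theorem restrict_dilationCovariantAt {P : ℝ → (ℝ → ℂ) → Prop} {a : ℝ}
    (hcov : W.DilationCovariantAt a)
    (hP : ∀ ⦃f : ℝ → ℂ⦄ ⦃η : ℝ⦄, W.Adm a f → P a f → -(1 / 2 : ℝ) ≤ η → η ≤ 1 →
      P (a / (1 + η)) (weilDilate η f)) :
    (W.restrict P).DilationCovariantAt a :=
  fun _ _ hf hη hη1 ↦ ⟨hcov hf.1 hη hη1, hP hf.1 hf.2 hη hη1⟩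

/-- **The edge law for every dilation-covariant sub-family** (Galerkin sections with dilated trial
spaces included): at a window `a` where the restricted bottom `ε_P` is differentiable and attained by
`u` (in the sub-family) with profile derivative `V`: `a · ε_P'(a) = −V`. [folklore] -/
theorem mul_deriv_restrict_energy_eq_neg {P : ℝ → (ℝ → ℂ) → Prop} {a : ℝ} {u : ℝ → ℂ}
    (hcov : W.DilationCovariantAt a)
    (hP : ∀ ⦃f : ℝ → ℂ⦄ ⦃η : ℝ⦄, W.Adm a f → P a f → -(1 / 2 : ℝ) ≤ η → η ≤ 1 →
      P (a / (1 + η)) (weilDilate η f))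
    (hu : (W.restrict P).IsGround a u) (hd : DifferentiableAt ℝ (W.restrict P).energy a) {V : ℝ}
    (hV : HasDerivAt (fun η : ℝ ↦ W.form (weilDilate η u)) V 0) :
    a * deriv (W.restrict P).energy a = -V :=
  mul_deriv_energy_eq_neg (restrict_dilationCovariantAt hcov hP) hu hd hV

end WindowForm

/-! ## §2 Instance: ζ's Weil form -/

/-- Admissible unit states of the window `[-b, b]` for ζ's Weil form read at the reference window
`2A`: `0 < b ≤ 2A`, `f ∈ L²`, `f = 0` at every `|x| ≥ b`, unit mass, finite archimedean energy.
[folklore] -/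
def weilAdm (A b : ℝ) (f : ℝ → ℂ) : Prop :=
  0 < b ∧ b ≤ 2 * A ∧ MemLp f 2 ∧ (∀ x, b ≤ |x| → f x = 0) ∧ (∫ x, ‖f x‖ ^ 2 = (1 : ℝ)) ∧
    IntegrableOn (fun t ↦ weilArchDensity t * weilIncrement f t) (Ioi 0)

/-- The variational principle for ζ's Weil form: `ε(b) ≤ weilClosedForm (2A) f` for every admissible
unit state `f` of the window `b ≤ 2A` (`stub_formDomainPos` at the window `b`, then the window
change `b → 2A`). [cite: Bombieri2000Weil, §4 Thm 3] -/
theorem weilGroundEnergy_le_weilClosedForm {A b : ℝ} {f : ℝ → ℂ} (h : weilAdm A b f) :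
    weilGroundEnergy b ≤ weilClosedForm (2 * A) f := by
  obtain ⟨hb, hbA, hf2, hfs, hN, hE⟩ := h
  have hC1 := stub_formDomainPos b hb f hf2
    (Eventually.of_forall fun x hx ↦ hfs x (not_le.1 fun h ↦ hx (abs_le.1 h)).le) hE
  have hW := stub_localizedCut_energy_window hf2 hbA hfs
  rw [hN, mul_one] at hC1
  rw [hN, mul_one, mul_one] at hW
  unfold weilClosedForm
  rw [hN, mul_one]
  linarith

/-- **ζ's Weil form is a windowed form** (reference window `2A`). [cite: Bombieri2000Weil, §4 Thm 3] -/
def weilWindowForm (A : ℝ) : WindowForm where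
  form := weilClosedForm (2 * A)
  Adm := weilAdm A
  energy := weilGroundEnergy
  energy_le := fun _ _ h ↦ weilGroundEnergy_le_weilClosedForm h

/-- ζ's windowed form is dilation-covariant at every window `a ≤ A` (unitarity of the dilation,
`integrableOn_arch_weilDilate`, and `a/(1+η) ≤ 2a ≤ 2A`). [cite: Bombieri2000Weil, §4 proof of Thm 5 (the dilation)] -/
theorem weilWindowForm_dilationCovariantAt {A a : ℝ} (haA : a ≤ A) :
    (weilWindowForm A).DilationCovariantAt a := by
  intro f η h hη hη1
  obtain ⟨ha, -, hf2, hfs, hN, hE⟩ := h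
  have hη' : -1 < η := by linarith
  have hc : 0 < 1 + η := by linarith
  refine ⟨div_pos ha hc, ?_, memLp_weilDilate hf2 hη',
    fun x hx ↦ weilDilate_eq_zero_of_le_abs hη' hfs hx, ?_,
    integrableOn_arch_weilDilate ha hη' hη1 hf2 hfs hE⟩
  · rw [div_le_iff₀ hc]
    have h1 : 0 ≤ a * (1 + 2 * η) := mul_nonneg ha.le (by linarith)
    have h2 : a * (1 + η) ≤ A * (1 + η) := mul_le_mul_of_nonneg_right haA hc.le
    nlinarith
  · show ∫ x, ‖weilDilate η f x‖ ^ 2 = 1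
    rw [integral_norm_sq_weilDilate _ hη', hN]

/-- The open-window truncation of a Weil ground state of the window `a ≤ A` is a ground state of
`weilWindowForm A` (`stub_groundStateEnergy` for `≤`, the variational principle for `≥`).
[cite: Bombieri2000Weil, §4 Thm 3] -/
theorem isGround_weilWindowForm {A a : ℝ} {u : ℝ → ℂ} (hu : IsWeilGroundState a u) (haA : a ≤ A) :
    (weilWindowForm A).IsGround a (weilTrunc a u) := by
  have ha : 0 < a := hu.pos
  have hvg : IsWeilGroundState a (weilTrunc a u) := isWeilGroundState_weilTrunc hu
  have hv2 : MemLp (weilTrunc a u) 2 := hvg.memLp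
  have hvs : ∀ x, a ≤ |x| → weilTrunc a u x = 0 := fun x hx ↦ weilTrunc_eq_zero u hx
  obtain ⟨hvE, hC2⟩ := stub_groundStateEnergy a _ hvg
  have hN : ∫ x, ‖weilTrunc a u x‖ ^ 2 = 1 := hvg.integral_norm_sq
  have hAdm : weilAdm A a (weilTrunc a u) := ⟨ha, by linarith, hv2, hvs, hN, hvE⟩
  refine ⟨hAdm, le_antisymm ?_ (weilGroundEnergy_le_weilClosedForm hAdm)⟩
  have hW := stub_localizedCut_energy_window hv2 (by linarith : a ≤ 2 * A) hvs
  rw [hN, mul_one] at hC2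
  rw [hN, mul_one, mul_one] at hW
  show weilClosedForm (2 * A) (weilTrunc a u) ≤ weilGroundEnergy a
  unfold weilClosedForm
  rw [hN, mul_one]
  linarith

/-- The profile of `weilWindowForm a` along the truncated ground state IS the tree's
`weilDilationProfile a u`. [folklore] -/
theorem weilWindowForm_profile (a : ℝ) (u : ℝ → ℂ) :
    (weilWindowForm a).profile (weilTrunc a u) = weilDilationProfile a u := rfl

/-- **The edge law for ζ with the profile read at ANY reference window `A ≥ a`** (instance of the
universal theorem; for `A = a` the profile is `weilDilationProfile a u` by `weilWindowForm_profile`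
and this is the tree's `mul_deriv_weilGroundEnergy_eq_neg`): `a · ε'(a) = −V` for every Weil ground
state `u` of a differentiability window `a` whose profile `η ↦ weilClosedForm (2A) (ũ_η)` has
derivative `V` at `0`.  In particular the virial does not depend on the reference window.
[cite: Kato1966, VII §4.6 and VII §6.5 (Hellmann–Feynman for forms; forms with varying domain)] -/
theorem mul_deriv_weilGroundEnergy_eq_neg_of_le {A a : ℝ} {u : ℝ → ℂ} (haA : a ≤ A)
    (hu : IsWeilGroundState a u) (hd : DifferentiableAt ℝ weilGroundEnergy a) {V : ℝ}
    (hV : HasDerivAt (fun η : ℝ ↦ weilClosedForm (2 * A) (weilDilate η (weilTrunc a u))) V 0) :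
    a * deriv weilGroundEnergy a = -V :=
  WindowForm.mul_deriv_energy_eq_neg (weilWindowForm_dilationCovariantAt haA)
    (isGround_weilWindowForm hu haA) hd hV

/-- Reference-window independence of the virial: if the profiles of a ground state read at two
reference windows `A, A' ≥ a` are differentiable at `0` (at a differentiability window of `ε`), the
two derivatives agree. [folklore] -/
theorem weilProfile_deriv_eq_of_le {A A' a : ℝ} {u : ℝ → ℂ} (haA : a ≤ A) (haA' : a ≤ A')
    (hu : IsWeilGroundState a u) (hd : DifferentiableAt ℝ weilGroundEnergy a) {V V' : ℝ}
    (hV : HasDerivAt (fun η : ℝ ↦ weilClosedForm (2 * A) (weilDilate η (weilTrunc a u))) V 0)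
    (hV' : HasDerivAt (fun η : ℝ ↦ weilClosedForm (2 * A') (weilDilate η (weilTrunc a u))) V' 0) :
    V = V' := by
  have h1 := mul_deriv_weilGroundEnergy_eq_neg_of_le haA hu hd hV
  have h2 := mul_deriv_weilGroundEnergy_eq_neg_of_le haA' hu hd hV'
  linarith

end Summit.RiemannHypothesis.RiemannHypothesis.Theorems.PfPersistence

end
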